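import Summits.ABC.IUTFork.Repair.RHSigmaStrataEq
import Summits.ABC.IUTFork.Cor312PilotIdelesPrProfile
import HarnessLib

/-!
# R-H ROUND 2, Q2/Q3 rows 3/4/5 — an EXPLICIT, hull-free MAJORANT of the off-Σ remainder at the genuine bed: the off-Σ PILOT GAP
# `R_Σ(T) ≤ (1/l⋇)·Σ_{(j,p) ∉ Σ} (j² − 1)·|−|log(q)|_{j,p}|` (realising ideles; any stratum Σ, in particular Σ₄)

abc-iut cell, rung LADDER-ABC:A2.RESCUE.H, R-H ROUND 2 seat abc-iut-rh2-q2-eq (rows 3/4/5). PROOF-ONLY file (0 definitions, 0 `Prop` facts) over this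
seat's `RHSigmaLicence` (p468453: `offRemainder`, `offImageGap`, `offRemainder_le_offImageGap`) and `RHSigmaStrataEq` (p470233: Σ₄ = `sigmaNu`,
`statementUpTo_offRemainder_sigmaNu`), composing BY NAME abc-iut-c312-7's pilot-idele profile at the sharp print-normalised setting
(`Cor312PilotIdelesPrProfile`: `logvol_thetaRegion_settingPrVolSharp_eq_sq_mul_qLocal` — every Kummer image of the Θ-pilot object at `(j, p)` has
log-volume `j²·(−|log(q)|_{j,p})` for REALISING ideles —, `qLocal_settingPrVolSharp_nonpos`, `thetaRegion3_settingPrVolSharp_eq`, `logvol_situationPrVol_inl`).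
WHY: the remainder `R_Σ = PN Σ_{off Σ} (q-volume − HULL-volume)⁺` needs the hull; but the hull CONTAINS the (Ind3)-enlarged Θ-pilot region, so cell by cell
`(q-volume − hull-volume)⁺ ≤ (q-volume − Θ-region-volume)⁺ = (j² − 1)·|q-volume|` (`offRemainder_le_offImageGap` with the global choice `U_Θ :=` the
Θ-regions). RESULTS:
* `imageGap_thetaRegion3_inr` / `_inl` — the summand of `offImageGap` along `U_Θ` in CLOSED FORM: `((i+1)² − 1)·(−qLocal_{i+1,p})` at a prime cell,
  `0` at an archimedean cell;
* **`offRemainder_le_offPilotGap`** — for ANY stratum `σ`: `R_σ ≤ PN(i ↦ Σᶠ_{v_ℚ} 1_{σᶜ}(i,v_ℚ)·pilotGap(i,v_ℚ))` with `pilotGap(i, p) = ((i+1)²−1)·|qLocal_{i+1,p}|`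
  (`= ((i+1)²−1)·(1/[F:ℚ])·Σ_{v|p} P_q(v)·log N(v)`, abc-iut-c312-7 `qLocal_settingPrVol_qCentreDH_inr`) — an IDELE-FREE, HULL-FREE number read off the
  q-pilot divisor and the off-Σ cell set alone;
* **`statementUpTo_offPilotGap_sigmaNu`** — hypothesis-free at the bed: the typed Cor. 3.12 holds UP TO THE OFF-Σ₄ PILOT GAP.
READING for Q3 («within tolerance for `l ≫ 0`?», numbers not adjectives): a prime cell `(j, p)` off Σ₄ costs at most `(j²−1)·|qLocal_p|/l⋇ ≤ (l⋇+1)·|qLocal_p|`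
(top label), all labels off at `p` cost `(κ−1)·|qLocal_p|`, `κ = (l⋇+1)(2l⋇+1)/6`; against abc-iut-rh2-q2-cond's constant-level tolerance
`Tol(P,l) = ((l+1)/4)·5·(2¹²·3³·5·d_mod)·l` (p469667) a single top-label off-cell at `p` is absorbed iff `|qLocal_p| ≲ 1.7·10⁶·d_mod·l` and a fully-off
prime iff `|qLocal_p| ≲ 8.3·10⁶·d_mod` (degree-normalised local q-volume `(1/[K:ℚ])·Σ_{w|p} P_q(w)·log N(w)`); summing over ALL cells gives
`(κ−1)·|−|log(q)||`, the full Θ/q pilot gap (never tolerated for large `l`: it is the exponent-level loss of xi-1's `OffSigmaTolerance` with `κ ≥ 1`).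
HONEST FRAMING: an UPPER bound on OUR remainder by OUR pilot volumes; nothing here asserts that abc is proved or refuted, or that [IUTchIII] Cor. 3.12 holds
or fails at any datum, or takes a side on any author; typed ≠ proved. [claim: Mochizuki2012, status: disputed] for every IUT locution.
[cite: Mochizuki2012, IUTchIII Cor. 3.12 p. 173–174, Def. 3.8 (i), Rmk. 3.12.2 (ii) p. 175; IUTchI Ex. 3.2 (iv) p. 71] [cite: DupuyHilado2025, §3.3, §3.9, Thm. 3.10.1, §4.10]
-/

noncomputable section

open Set Function NumberField IsDedekindDomain
open scoped Pointwise

namespace Summit.ABC.IUTFork.Repair.RH.SigmaStrataEq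

open Summit.ABC.IUTFork.Thm311 Summit.ABC.IUTFork.Thm311.Real Summit.ABC.IUTFork.Cor312 Summit.ABC.IUTFork.Cor312.Setting
  Summit.ABC.IUTFork.Cor312Vol Summit.ABC.IUTFork.Cor312Prov Literature.IUT.LogThetaLattice Literature.IUT.LogVolume
  Literature.IUT.HodgeTheaters Literature.IUT.LogVolume.ThetaData
  Summit.ABC.IUTFork.Repair.RH.SigmaLicence

section PilotGap

variable {F : Type} [Field F] [NumberField F] (X : PilotData F) {logv : PadicLogs F} (hlog : LogvAnalytic logv)
  (M : Type) [Field M] [NumberField M]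
  (archPk : ∀ (j : (thetaIndex X).Label) (vQ : (thetaIndex X).VQ), Set ((logShellsDH X logv).Packet j vQ))
  (archSub : ∀ (j : (thetaIndex X).Label) (v : (thetaIndex X).V),
    Set ((logShellsDH X logv).Packet j ((thetaIndex X).over v)))
  (Ψ : ℤ → ∀ v : (thetaIndex X).V, v ∈ (thetaIndex X).Vbad → Set ((logShellsDH X logv).StarPacket v))
  (act : ℤ → ∀ v : (thetaIndex X).V, v ∈ (thetaIndex X).Vbad →
    (logShellsDH X logv).StarPacket v → Module.End ℚ ((logShellsDH X logv).StarPacket v))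
  (Mmod : ℤ → ∀ j : (thetaIndex X).LabelStar, Set ((logShellsDH X logv).GlobalPacket j.1))
  (region : ℤ → ∀ j : (thetaIndex X).LabelStar, FinDivisor M → ∀ vQ : (thetaIndex X).VQ,
    Set ((logShellsDH X logv).Packet j.1 vQ))
  (n : ℤ) {HT : Type} {LogLink : HT → HT → Type} {IsFull : ∀ {s t : HT}, LogLink s t → Prop}
  (lat : LGPGaussianLogThetaLattice LogLink IsFull)
  {Frd : Type} {IsoF : Frd → Frd → Type} {Ob : Frd → Type} {realify : Frd → Frd} {Strip : Type}
  {IsoS : Strip → Strip → Type} {Mv : ∀ v : (thetaIndex X).V, v ∈ (thetaIndex X).Vbad → Type}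
  [∀ v h, Monoid (Mv v h)]
  (sig : GlobalLGPFrobenioidSignature (thetaIndex X).lstar (thetaIndex X).V (· ∈ (thetaIndex X).Vbad)
    Frd IsoF Ob realify Strip IsoS Mv)
  (split : SplittingMonoids Mv) {ObΔ : Type} {N : ∀ v : (thetaIndex X).V, v ∈ (thetaIndex X).Vbad → Type}
  [∀ v h, Monoid (N v h)] (qData : QPilotData ObΔ N)
  (tq : ∀ (pp : Nat.Primes) (x : (thetaIndex X).Fibre (.inr pp)), haveI : Fact (pp : ℕ).Prime := ⟨pp.2⟩; kOf X pp.1 x)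
  (t : ∀ (pp : Nat.Primes) (_ : Fin X.lstar) (x : (thetaIndex X).Fibre (.inr pp)),
    haveI : Fact (pp : ℕ).Prime := ⟨pp.2⟩; kOf X pp.1 x)
  (htq0 : ∀ pp x, tq pp x ≠ 0)
  (htq1 : ∀ (pp : Nat.Primes) (x : (thetaIndex X).Fibre (.inr pp)),
    haveI : Fact (pp : ℕ).Prime := ⟨pp.2⟩; placeOf X pp.1 x ∉ X.S → ‖tq pp x‖ = 1)

/-- At an ARCHIMEDEAN cell the image gap along the Θ-regions vanishes (trivial archimedean container: every region has log-volume `0`,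
abc-iut-c312-7 `logvol_situationPrVol_inl`). [folklore] -/
theorem imageGap_thetaRegion3_inl (i : Fin (thetaIndex X).lstar) (u : Unit) :
    max ((settingPrVolSharp X hlog M archPk archSub Ψ act Mmod region n lat sig split qData tq t htq0 htq1).qLocal (labelSucc i) (.inl u) -
        ((situationPrVol X hlog M archPk archSub Ψ act Mmod region).D n).logvol (labelSucc i) (.inl u)
          ((settingPrVolSharp X hlog M archPk archSub Ψ act Mmod region n lat sig split qData tq t htq0 htq1).thetaRegion3
            (labelSucc i) (.inl u))) 0 = 0 := by
  have h1 : (settingPrVolSharp X hlog M archPk archSub Ψ act Mmod region n lat sig split qData tq t htq0 htq1).qLocal (labelSucc i)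
      (.inl u) = 0 :=
    logvol_situationPrVol_inl X hlog M archPk archSub Ψ act Mmod region n u (labelSucc i) _
  rw [h1, logvol_situationPrVol_inl X hlog M archPk archSub Ψ act Mmod region n u (labelSucc i) _, sub_zero, max_self]

/-- **At a PRIME cell `(i+1, p)`, for REALISING ideles, the image gap along the Θ-regions is `((i+1)² − 1)·(−qLocal_{i+1,p})`** — the (Ind3)-enlarged
Θ-pilot region is the single sharp box (`thetaRegion3_settingPrVolSharp_eq`) of log-volume `(i+1)²·qLocal` (abc-iut-c312-7
`logvol_thetaRegion_settingPrVolSharp_eq_sq_mul_qLocal`), and `qLocal ≤ 0` (`qLocal_settingPrVolSharp_nonpos`). [cite: DupuyHilado2025, §3.3, Thm. 3.10.1, §4.10]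
[claim: Mochizuki2012, status: disputed] -/
theorem imageGap_thetaRegion3_inr (ht0 : ∀ pp i x, t pp i x ≠ 0)
    (ht : ∀ (pp : Nat.Primes) (i : Fin X.lstar) (x : (thetaIndex X).Fibre (.inr pp)),
      haveI : Fact (pp : ℕ).Prime := ⟨pp.2⟩
      Real.log ‖t pp i x‖ = -(X.thetaPilot i (placeOf X pp.1 x)) * logNorm F (placeOf X pp.1 x) / localDegree F (placeOf X pp.1 x))
    (htq : ∀ (pp : Nat.Primes) (x : (thetaIndex X).Fibre (.inr pp)),
      haveI : Fact (pp : ℕ).Prime := ⟨pp.2⟩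
      Real.log ‖tq pp x‖ = -(X.qPilot (placeOf X pp.1 x)) * logNorm F (placeOf X pp.1 x) / localDegree F (placeOf X pp.1 x))
    (i : Fin (thetaIndex X).lstar) (pp : Nat.Primes) :
    max ((settingPrVolSharp X hlog M archPk archSub Ψ act Mmod region n lat sig split qData tq t htq0 htq1).qLocal (labelSucc i) (.inr pp) -
        ((situationPrVol X hlog M archPk archSub Ψ act Mmod region).D n).logvol (labelSucc i) (.inr pp)
          ((settingPrVolSharp X hlog M archPk archSub Ψ act Mmod region n lat sig split qData tq t htq0 htq1).thetaRegion3
            (labelSucc i) (.inr pp))) 0 =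
      ((((i : ℕ) : ℝ) + 1) ^ 2 - 1) *
        (-(settingPrVolSharp X hlog M archPk archSub Ψ act Mmod region n lat sig split qData tq t htq0 htq1).qLocal (labelSucc i) (.inr pp)) := by
  rw [thetaRegion3_settingPrVolSharp_eq X hlog M archPk archSub Ψ act Mmod region n lat sig split qData t tq htq0 htq1 0,
    logvol_thetaRegion_settingPrVolSharp_eq_sq_mul_qLocal X hlog M archPk archSub Ψ act Mmod region n lat sig split qData t ht0 ht tq htq0
      htq1 htq 0 i pp]
  have hq := qLocal_settingPrVolSharp_nonpos X hlog M archPk archSub Ψ act Mmod region n lat sig split qData t tq htq0 htq1 htq (labelSucc i) pp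
  have hsq : (1 : ℝ) ≤ (((i : ℕ) : ℝ) + 1) ^ 2 := by nlinarith [(Nat.cast_nonneg (i : ℕ) : (0 : ℝ) ≤ (i : ℕ))]
  rw [max_eq_left (by nlinarith)]
  ring

/-- **THE OFF-Σ PILOT GAP MAJORANT**: at the sharp print-normalised setting of any Dupuy–Hilado pilot datum, for REALISING ideles (non-zero, units off
`S`) and ANY stratum `σ`, the off-σ remainder is at most the procession-normalised sum over the off-σ PRIME cells of `((i+1)² − 1)·(−qLocal_{i+1,p})`
— a hull-free, idele-free number read off the q-pilot divisor and the cell set. (`offRemainder_le_offImageGap` with the Θ-regions as the global choice,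
summand in closed form by `imageGap_thetaRegion3_inr/_inl`.) [cite: DupuyHilado2025, §3.3, §3.9, Thm. 3.10.1] [claim: Mochizuki2012, status: disputed] -/
theorem offRemainder_le_offPilotGap (ht0 : ∀ pp i x, t pp i x ≠ 0)
    (ht1 : ∀ (pp : Nat.Primes) (i : Fin X.lstar) (x : (thetaIndex X).Fibre (.inr pp)),
      haveI : Fact (pp : ℕ).Prime := ⟨pp.2⟩; placeOf X pp.1 x ∉ X.S → ‖t pp i x‖ = 1)
    (ht : ∀ (pp : Nat.Primes) (i : Fin X.lstar) (x : (thetaIndex X).Fibre (.inr pp)),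
      haveI : Fact (pp : ℕ).Prime := ⟨pp.2⟩
      Real.log ‖t pp i x‖ = -(X.thetaPilot i (placeOf X pp.1 x)) * logNorm F (placeOf X pp.1 x) / localDegree F (placeOf X pp.1 x))
    (htq : ∀ (pp : Nat.Primes) (x : (thetaIndex X).Fibre (.inr pp)),
      haveI : Fact (pp : ℕ).Prime := ⟨pp.2⟩
      Real.log ‖tq pp x‖ = -(X.qPilot (placeOf X pp.1 x)) * logNorm F (placeOf X pp.1 x) / localDegree F (placeOf X pp.1 x))
    (σ : Set (Fin (thetaIndex X).lstar × (thetaIndex X).VQ)) :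
    offRemainder (settingPrVolSharp X hlog M archPk archSub Ψ act Mmod region n lat sig split qData tq t htq0 htq1) σ ≤
      processionNormalized fun i : Fin (thetaIndex X).lstar =>
        ∑ᶠ vQ : (thetaIndex X).VQ, σᶜ.indicator
          (fun c : Fin (thetaIndex X).lstar × (thetaIndex X).VQ =>
            Sum.elim (fun _ : Unit => (0 : ℝ))
              (fun pp : Nat.Primes => ((((c.1 : ℕ) : ℝ) + 1) ^ 2 - 1) *
                (-(settingPrVolSharp X hlog M archPk archSub Ψ act Mmod region n lat sig split qData tq t htq0 htq1).qLocal
                  (labelSucc c.1) (.inr pp))) c.2) (i, vQ) := by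
  -- the global choice of possible images `U_Θ :=` the (Ind3)-enlarged Θ-pilot regions
  let UΘ : ImageChoice (settingPrVolSharp X hlog M archPk archSub Ψ act Mmod region n lat sig split qData tq t htq0 htq1) :=
    ⟨fun c => (settingPrVolSharp X hlog M archPk archSub Ψ act Mmod region n lat sig split qData tq t htq0 htq1).thetaRegion3 _ c.2,
      fun c => (settingPrVolSharp X hlog M archPk archSub Ψ act Mmod region n lat sig split qData tq t htq0 htq1).thetaRegion3_mem_possibleImages
        _ c.2⟩
  have H := bridgeHyps_settingPrVolSharp_of_ideles X hlog M archPk archSub Ψ act Mmod region n lat sig split qData t tq ht0 ht1 htq0 htq1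
  refine (offRemainder_le_offImageGap H σ UΘ).trans_eq ?_
  unfold offImageGap
  congr 1
  funext i
  refine finsum_congr fun vQ => ?_
  by_cases hm : (i, vQ) ∈ σᶜ
  · rw [Set.indicator_of_mem hm, Set.indicator_of_mem hm]
    cases vQ with
    | inl u =>
      exact imageGap_thetaRegion3_inl X hlog M archPk archSub Ψ act Mmod region n lat sig split qData tq t htq0 htq1 i u
    | inr pp =>
      exact imageGap_thetaRegion3_inr X hlog M archPk archSub Ψ act Mmod region n lat sig split qData tq t htq0 htq1 ht0 ht htq i pp
  · rw [Set.indicator_of_notMem hm, Set.indicator_of_notMem hm]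

/-- **Hypothesis-free at the bed: the typed Cor. 3.12 holds UP TO THE OFF-Σ₄ PILOT GAP** (`statementUpTo_offRemainder_sigmaNu` ∘ the majorant): for
REALISING ideles, `−|log(q)| ≤ −|log(Θ)| + PN(Σᶠ_{(i,p) ∉ Σ₄} ((i+1)²−1)·|qLocal_{i+1,p}|)`. The hull appears only through the cell set Σ₄.
[cite: Mochizuki2012, IUTchIII Cor. 3.12 p. 173–174] [cite: DupuyHilado2025, §3.3, Thm. 3.10.1] [claim: Mochizuki2012, status: disputed] -/
theorem statementUpTo_offPilotGap_sigmaNu (ht0 : ∀ pp i x, t pp i x ≠ 0)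
    (ht1 : ∀ (pp : Nat.Primes) (i : Fin X.lstar) (x : (thetaIndex X).Fibre (.inr pp)),
      haveI : Fact (pp : ℕ).Prime := ⟨pp.2⟩; placeOf X pp.1 x ∉ X.S → ‖t pp i x‖ = 1)
    (ht : ∀ (pp : Nat.Primes) (i : Fin X.lstar) (x : (thetaIndex X).Fibre (.inr pp)),
      haveI : Fact (pp : ℕ).Prime := ⟨pp.2⟩
      Real.log ‖t pp i x‖ = -(X.thetaPilot i (placeOf X pp.1 x)) * logNorm F (placeOf X pp.1 x) / localDegree F (placeOf X pp.1 x))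
    (htq : ∀ (pp : Nat.Primes) (x : (thetaIndex X).Fibre (.inr pp)),
      haveI : Fact (pp : ℕ).Prime := ⟨pp.2⟩
      Real.log ‖tq pp x‖ = -(X.qPilot (placeOf X pp.1 x)) * logNorm F (placeOf X pp.1 x) / localDegree F (placeOf X pp.1 x)) :
    StatementUpTo (settingPrVolSharp X hlog M archPk archSub Ψ act Mmod region n lat sig split qData tq t htq0 htq1)
      (processionNormalized fun i : Fin (thetaIndex X).lstar =>
        ∑ᶠ vQ : (thetaIndex X).VQ,
          (sigmaNu X hlog M archPk archSub Ψ act Mmod region n lat sig split qData tq t htq0 htq1)ᶜ.indicator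
            (fun c : Fin (thetaIndex X).lstar × (thetaIndex X).VQ =>
              Sum.elim (fun _ : Unit => (0 : ℝ))
                (fun pp : Nat.Primes => ((((c.1 : ℕ) : ℝ) + 1) ^ 2 - 1) *
                  (-(settingPrVolSharp X hlog M archPk archSub Ψ act Mmod region n lat sig split qData tq t htq0 htq1).qLocal
                    (labelSucc c.1) (.inr pp))) c.2) (i, vQ)) :=
  statementUpTo_mono
    (offRemainder_le_offPilotGap X hlog M archPk archSub Ψ act Mmod region n lat sig split qData tq t htq0 htq1 ht0 ht1 ht htq _)
    (statementUpTo_offRemainder_sigmaNu X hlog M archPk archSub Ψ act Mmod region n lat sig split qData tq t htq0 htq1 ht0 ht1)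

end PilotGap

end Summit.ABC.IUTFork.Repair.RH.SigmaStrataEq

end
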